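import Summits.KontsevichZagierPeriods.Zeta5Search.TwoTaleLineBoundRCT
import Summits.KontsevichZagierPeriods.Zeta5Search.TwoTaleLineBoundScaling
import Summits.KontsevichZagierPeriods.Zeta5Search.TwoTaleLineBoundLipschitz
import Summits.KontsevichZagierPeriods.Zeta5Search.TwoTaleLineBoundStirling
import Summits.KontsevichZagierPeriods.Zeta5Search.TwoTaleP15SecondLineProfileShape
import Summits.KontsevichZagierPeriods.Zeta5Search.TwoTaleP15SecondTaleCrude

/-!
# P15, second tale: the scaled line bound `log ‖R̂_n‖ ≤ n·profileT0(−8.97, η) + O(log n + log(484+η²))` (U2-4)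

HONEST FRAMING: systematic search; no irrationality claim unless certified.  Real-variable bound for the modulus of
an explicit rational function; nothing about `ζ(2)`.

Cell pub-zeta5, P1 g10 for fam-measure g5's U2 chain (`Denom.TwoTaleP15Coincidence.DecayT c′`).  On ANY vertical line
within distance `1` of the design line `Re t = −(897/100)·n` of the second tale at the Remark-5 partner
(`Zudilin2014.RCT (aT n) (bT n)`, poles on `[−26n−1, −13n−1]`), at height `Im t = nη` (`η ≠ 0`, `n ≥ 4`):

* `prim_endpoint_D` — endpoint transfer with offset `D ≤ N/2` at scale `N` (legs `7/5 ≤ |V*| ≤ 18`, segment inside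
  `9/10 ≤ |W| ≤ 22`), `halfLog_endpoint_N`;
* **`log_norm_RCT_partner_line_le`**: `|u + (897/100)n| ≤ 1 →
  log ‖RCT (aT n) (bT n) (u + i·nη)‖ ≤ n·profileT0 (−897/100) η + 4 log n + 12 log(484+η²) + K0T`,
  `K0T = 20|log(9/10)| + 3 log 2 + log 11 + 4`, where `profileT0` is the gPrim-profile of
  `TwoTaleP15SecondLineProfileShape` (the doubled block `∏(2t+ℓ)` is an ordinary block for `2t`, scale `2n`, giving
  the weight `2` and the `17 log 2`; the `n log n` terms `17+5−11−11 = 0` cancel against Stirling for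
  `Π̂ = (11n)!²/((17n)!(5n)!)`).
With `TwoTaleP15SecondLineCertificate.certT_delta` (`sup_η (profileT0 − 2π|η|) ≤ −29.10786`) this is everything on the
`|R̂|` side of `DecayT`; what remains (fam-measure U2-1/2/3/5): the line representation of `q̂_nζ(2) − p̂_n` with kernel
`π/sin 2πt`, the strip shift to this line, and the `dy`-assembly.
-/

noncomputable section

open Real Complex
open Literature.NumberTheory.Irrationality.Zudilin2014

namespace Summit.KontsevichZagierPeriods.Zeta5Search.TwoTaleLineBound

open TwoTaleP15 (aT bT aT_zero aT_one aT_two aT_three bT_zero bT_one bT_two bT_three normT_partner_eq)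
open TwoTaleP15SecondLineProfileShape (profileT0 profileTConst)
open Denom.LineProfile (gPrim)

variable {η : ℝ}

/-- The Lipschitz constant of `prim η ·` on `9/10 ≤ |W| ≤ 22`. -/
def lipKT (η : ℝ) : ℝ := |Real.log (9 / 10)| + Real.log (22 ^ 2 + η ^ 2) / 2

/-- `0 ≤ lipKT η`. -/
theorem lipKT_nonneg (η : ℝ) : 0 ≤ lipKT η := by
  unfold lipKT
  have : 0 ≤ Real.log (22 ^ 2 + η ^ 2) := Real.log_nonneg (by nlinarith [sq_nonneg η])
  positivity

/-- **Endpoint transfer at scale `N` with offset `D`**: `|E − N V*| ≤ D`, `D ≤ N/2`, `7/5 ≤ |V*| ≤ 18` give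
`|prim (Nη) E − (N·prim η V* + E·log N)| ≤ D·lipKT η`. -/
theorem prim_endpoint_D (hη : η ≠ 0) {N D E Vs : ℝ} (hN : 0 < N) (hDN : D ≤ N / 2)
    (hE : |E - N * Vs| ≤ D) (hV1 : 7 / 5 ≤ |Vs|) (hV2 : |Vs| ≤ 18) :
    |prim (N * η) E - (N * prim η Vs + E * Real.log N)| ≤ D * lipKT η := by
  obtain ⟨V, hV⟩ : ∃ V : ℝ, V = E / N := ⟨_, rfl⟩
  have hEV : E = N * V := by rw [hV]; field_simp
  rw [hEV, prim_scale hN hη V, show N * prim η V + N * V * Real.log N - (N * prim η Vs + N * V * Real.log N) =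
    N * (prim η V - prim η Vs) by ring, abs_mul, abs_of_pos hN]
  have hdist : N * |V - Vs| ≤ D := by
    have : |E - N * Vs| = N * |V - Vs| := by rw [hEV, ← mul_sub, abs_mul, abs_of_pos hN]
    rw [← this]; exact hE
  have hdist' : |V - Vs| ≤ 1 / 2 := by
    have h1 : |V - Vs| ≤ D / N := by rw [le_div_iff₀ hN]; linarith
    have h2 : D / N ≤ 1 / 2 := by rw [div_le_iff₀ hN]; linarith
    linarith
  have hseg : ∀ W ∈ Set.uIcc Vs V, 9 / 10 ≤ |W| ∧ |W| ≤ 22 := by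
    intro W hW
    have hWd : |W - Vs| ≤ |V - Vs| := Set.abs_sub_left_of_mem_uIcc hW
    have h1 : |Vs| - |W - Vs| ≤ |W| := by
      have := abs_sub_abs_le_abs_sub Vs W
      rw [abs_sub_comm] at this
      linarith
    have h2 : |W| ≤ |Vs| + |W - Vs| := by
      have := abs_add_le Vs (W - Vs)
      simpa using this
    constructor <;> linarith
  have hL := abs_prim_sub_prim_le hη (m := 9 / 10) (M := 22) (by norm_num) (by norm_num) hseg
  have hK := lipKT_nonneg η
  calc N * |prim η V - prim η Vs| ≤ N * ((|Real.log (9 / 10)| + Real.log (22 ^ 2 + η ^ 2) / 2) * |V - Vs|) :=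
        mul_le_mul_of_nonneg_left hL hN.le
    _ = lipKT η * (N * |V - Vs|) := by unfold lipKT; ring
    _ ≤ lipKT η * D := mul_le_mul_of_nonneg_left hdist hK
    _ = D * lipKT η := by ring

/-- An endpoint halfLog term at scale `N ≥ 1`: `halfLog (Nη) E ≤ log N + ½log(22²+η²)` when `|E| ≤ 22N`. -/
theorem halfLog_endpoint_N (hη : η ≠ 0) {N E : ℝ} (hN : 1 ≤ N) (hE : |E| ≤ 22 * N) :
    halfLog (N * η) E ≤ Real.log N + Real.log (22 ^ 2 + η ^ 2) / 2 := by
  have hN0 : 0 < N := by linarith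
  obtain ⟨V, hV⟩ : ∃ V : ℝ, V = E / N := ⟨_, rfl⟩
  have hEV : E = N * V := by rw [hV]; field_simp
  rw [hEV, halfLog_scale hN0 hη V]
  have hVb : |V| ≤ 22 := by
    rw [hV, abs_div, abs_of_pos hN0, div_le_iff₀ hN0]; exact hE
  have hV2 : V ^ 2 ≤ 22 ^ 2 := by nlinarith [abs_nonneg V, sq_abs V, abs_le.1 hVb]
  have h2 : Real.log (V ^ 2 + η ^ 2) ≤ Real.log (22 ^ 2 + η ^ 2) :=
    Real.log_le_log (by positivity) (by nlinarith)
  have h3 : halfLog η V ≤ Real.log (22 ^ 2 + η ^ 2) / 2 := by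
    unfold halfLog; exact div_le_div_of_nonneg_right h2 (by norm_num)
  exact add_le_add_right h3 (Real.log N)

/-- `gPrim = prim` (fam-denom's primitive and P1's are the same function). -/
theorem gPrim_eq_prim (η w : ℝ) : gPrim η w = prim η w := by
  unfold gPrim prim; ring

/-- The constant of the scaled line bound. -/
def K0T : ℝ := 20 * |Real.log (9 / 10)| + 3 * Real.log 2 + Real.log 11 + 4

set_option maxHeartbeats 400000 in
/-- **The scaled line bound for the second tale at P15 (U2-4)**: for `n ≥ 4`, `η ≠ 0` and any abscissa `u` with
`|u + (897/100)n| ≤ 1`,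
`log ‖R̂_n(u + i·nη)‖ ≤ n·profileT0 (−897/100) η + 4 log n + 12 log(22² + η²) + K0T`. -/
theorem log_norm_RCT_partner_line_le (hη : η ≠ 0) {n : ℕ} (hn : 4 ≤ n) {u : ℝ}
    (hu : |u + 897 / 100 * n| ≤ 1) :
    Real.log ‖RCT (aT n) (bT n) ((u : ℂ) + (((n : ℝ) * η : ℝ) : ℂ) * I)‖ ≤
      n * profileT0 (-897 / 100) η + 4 * Real.log n + 12 * Real.log (22 ^ 2 + η ^ 2) + K0T := by
  have hn0 : (0 : ℝ) < n := by exact_mod_cast (show 0 < n by omega)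
  have hn1 : (1 : ℝ) ≤ n := by exact_mod_cast (show 1 ≤ n by omega)
  have hn4 : (4 : ℝ) ≤ n := by exact_mod_cast hn
  have hy : (n : ℝ) * η ≠ 0 := mul_ne_zero hn0.ne' hη
  obtain ⟨hu1, hu2⟩ := abs_le.1 hu
  -- the block bound, normalised
  have hB : Real.log ‖RCT (aT n) (bT n) ((u : ℂ) + (((n : ℝ) * η : ℝ) : ℂ) * I)‖ ≤
      Real.log |normT (aT n) (bT n)|
      + ((prim (2 * (n * η)) (2 * u + (32 * n + 1)) - prim (2 * (n * η)) (2 * u + (15 * n + 2)))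
          + halfLog (2 * (n * η)) (2 * u + (15 * n + 2)) + halfLog (2 * (n * η)) (2 * u + (32 * n + 1))
          + (1 + Real.log 2))
      + ((prim (n * η) (u + 11 * n) - prim (n * η) (u + (6 * n + 1))) + halfLog (n * η) (u + (6 * n + 1))
          + halfLog (n * η) (u + 11 * n) + (1 + Real.log 2))
      - (prim (n * η) (u + (24 * n + 1)) - prim (n * η) (u + 13 * n))
      - (prim (n * η) (u + (26 * n + 1)) - prim (n * η) (u + 15 * n)) := by
    refine (log_norm_RCT_le hy (a := aT n) (b := bT n) (by simp; omega) (by simp; omega) (by simp; omega)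
      (by simp; omega) (u := u) (by simp; linarith) (by simp; linarith)).trans (le_of_eq ?_)
    simp only [aT_zero, aT_one, aT_two, aT_three, bT_zero, bT_one, bT_two, bT_three]
    push_cast
    ring_nf
  -- the eight endpoints
  have e2n : 2 * ((n : ℝ) * η) = (2 * n) * η := by ring
  rw [e2n] at hB
  have v1 : (7:ℝ) / 5 ≤ |(703:ℝ) / 100| ∧ |(703:ℝ) / 100| ≤ 18 := by rw [abs_of_pos (by norm_num)]; norm_num
  have v2 : (7:ℝ) / 5 ≤ |(-147:ℝ) / 100| ∧ |(-147:ℝ) / 100| ≤ 18 := by rw [abs_of_neg (by norm_num)]; norm_num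
  have v3 : (7:ℝ) / 5 ≤ |(203:ℝ) / 100| ∧ |(203:ℝ) / 100| ≤ 18 := by rw [abs_of_pos (by norm_num)]; norm_num
  have v4 : (7:ℝ) / 5 ≤ |(-297:ℝ) / 100| ∧ |(-297:ℝ) / 100| ≤ 18 := by rw [abs_of_neg (by norm_num)]; norm_num
  have v5 : (7:ℝ) / 5 ≤ |(1503:ℝ) / 100| ∧ |(1503:ℝ) / 100| ≤ 18 := by rw [abs_of_pos (by norm_num)]; norm_num
  have v6 : (7:ℝ) / 5 ≤ |(403:ℝ) / 100| ∧ |(403:ℝ) / 100| ≤ 18 := by rw [abs_of_pos (by norm_num)]; norm_num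
  have v7 : (7:ℝ) / 5 ≤ |(1703:ℝ) / 100| ∧ |(1703:ℝ) / 100| ≤ 18 := by rw [abs_of_pos (by norm_num)]; norm_num
  have v8 : (7:ℝ) / 5 ≤ |(603:ℝ) / 100| ∧ |(603:ℝ) / 100| ≤ 18 := by rw [abs_of_pos (by norm_num)]; norm_num
  have h2n : (0 : ℝ) < 2 * n := by linarith
  obtain ⟨e1a, e1b⟩ := abs_le.1 (prim_endpoint_D hη (N := 2 * n) (D := 4) (E := 2 * u + (32 * n + 1))
    (Vs := 703 / 100) h2n (by linarith) (by rw [abs_le]; constructor <;> linarith) v1.1 v1.2)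
  obtain ⟨e2a, e2b⟩ := abs_le.1 (prim_endpoint_D hη (N := 2 * n) (D := 4) (E := 2 * u + (15 * n + 2))
    (Vs := -147 / 100) h2n (by linarith) (by rw [abs_le]; constructor <;> linarith) v2.1 v2.2)
  obtain ⟨e3a, e3b⟩ := abs_le.1 (prim_endpoint_D hη (N := n) (D := 2) (E := u + 11 * n)
    (Vs := 203 / 100) hn0 (by linarith) (by rw [abs_le]; constructor <;> linarith) v3.1 v3.2)
  obtain ⟨e4a, e4b⟩ := abs_le.1 (prim_endpoint_D hη (N := n) (D := 2) (E := u + (6 * n + 1))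
    (Vs := -297 / 100) hn0 (by linarith) (by rw [abs_le]; constructor <;> linarith) v4.1 v4.2)
  obtain ⟨e5a, e5b⟩ := abs_le.1 (prim_endpoint_D hη (N := n) (D := 2) (E := u + (24 * n + 1))
    (Vs := 1503 / 100) hn0 (by linarith) (by rw [abs_le]; constructor <;> linarith) v5.1 v5.2)
  obtain ⟨e6a, e6b⟩ := abs_le.1 (prim_endpoint_D hη (N := n) (D := 2) (E := u + 13 * n)
    (Vs := 403 / 100) hn0 (by linarith) (by rw [abs_le]; constructor <;> linarith) v6.1 v6.2)
  obtain ⟨e7a, e7b⟩ := abs_le.1 (prim_endpoint_D hη (N := n) (D := 2) (E := u + (26 * n + 1))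
    (Vs := 1703 / 100) hn0 (by linarith) (by rw [abs_le]; constructor <;> linarith) v7.1 v7.2)
  obtain ⟨e8a, e8b⟩ := abs_le.1 (prim_endpoint_D hη (N := n) (D := 2) (E := u + 15 * n)
    (Vs := 603 / 100) hn0 (by linarith) (by rw [abs_le]; constructor <;> linarith) v8.1 v8.2)
  -- the four endpoint halfLog terms
  have l1 := halfLog_endpoint_N hη (N := 2 * n) (E := 2 * u + (15 * n + 2)) (by linarith)
    (by rw [abs_le]; constructor <;> linarith)
  have l2 := halfLog_endpoint_N hη (N := 2 * n) (E := 2 * u + (32 * n + 1)) (by linarith)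
    (by rw [abs_le]; constructor <;> linarith)
  have l3 := halfLog_endpoint_N hη (N := n) (E := u + (6 * n + 1)) hn1 (by rw [abs_le]; constructor <;> linarith)
  have l4 := halfLog_endpoint_N hη (N := n) (E := u + 11 * n) hn1 (by rw [abs_le]; constructor <;> linarith)
  -- Stirling for Π̂ = (11n)!²/((17n)!(5n)!)
  have hN : Real.log |normT (aT n) (bT n)| = 2 * Real.log (Nat.factorial (11 * n)) - Real.log (Nat.factorial (17 * n))
      - Real.log (Nat.factorial (5 * n)) := by
    have e : (normT (aT n) (bT n) : ℝ) = ((Nat.factorial (11 * n) : ℝ) * (Nat.factorial (11 * n) : ℝ))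
        / ((Nat.factorial (17 * n) : ℝ) * (Nat.factorial (5 * n) : ℝ)) := by
      have h := congrArg (fun q : ℚ => (q : ℝ)) (normT_partner_eq n)
      push_cast at h
      exact h
    have f11 : (0 : ℝ) < Nat.factorial (11 * n) := by positivity
    have f17 : (0 : ℝ) < Nat.factorial (17 * n) := by positivity
    have f5 : (0 : ℝ) < Nat.factorial (5 * n) := by positivity
    rw [e, abs_of_pos (by positivity), Real.log_div (by positivity) (by positivity), Real.log_mul f11.ne' f11.ne',
      Real.log_mul f17.ne' f5.ne']
    ring
  have c11 : Real.log ((11 * n : ℕ) : ℝ) = Real.log 11 + Real.log n := by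
    push_cast; exact Real.log_mul (by norm_num) hn0.ne'
  have c17 : Real.log ((17 * n : ℕ) : ℝ) = Real.log 17 + Real.log n := by
    push_cast; exact Real.log_mul (by norm_num) hn0.ne'
  have c5 : Real.log ((5 * n : ℕ) : ℝ) = Real.log 5 + Real.log n := by
    push_cast; exact Real.log_mul (by norm_num) hn0.ne'
  have s11 := (log_factorial_two_sided (n := 11 * n) (by omega)).2
  have s17 := (log_factorial_two_sided (n := 17 * n) (by omega)).1
  have s5 := (log_factorial_two_sided (n := 5 * n) (by omega)).1
  rw [c11] at s11; rw [c17] at s17; rw [c5] at s5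
  simp only [Nat.cast_mul, Nat.cast_ofNat] at s11 s17 s5
  have hlogn : 0 ≤ Real.log n := Real.log_nonneg hn1
  have hlog2n : Real.log (2 * (n : ℝ)) = Real.log 2 + Real.log n := Real.log_mul (by norm_num) hn0.ne'
  have hlog17 : 0 ≤ Real.log 17 := Real.log_nonneg (by norm_num)
  have hlog5 : 0 ≤ Real.log 5 := Real.log_nonneg (by norm_num)
  have hlog11 : 0 ≤ Real.log 11 := Real.log_nonneg (by norm_num)
  have hlog2 : 0 ≤ Real.log 2 := Real.log_nonneg (by norm_num)
  -- linearise the products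
  have p1 : (2 * u + (32 * (n : ℝ) + 1)) * Real.log (2 * (n : ℝ))
      = 2 * (u * Real.log 2) + 2 * (u * Real.log n) + 32 * (n * Real.log 2) + 32 * (n * Real.log n)
        + Real.log 2 + Real.log n := by rw [hlog2n]; ring
  have p2 : (2 * u + (15 * (n : ℝ) + 2)) * Real.log (2 * (n : ℝ))
      = 2 * (u * Real.log 2) + 2 * (u * Real.log n) + 15 * (n * Real.log 2) + 15 * (n * Real.log n)
        + 2 * Real.log 2 + 2 * Real.log n := by rw [hlog2n]; ring
  have p3 : (u + 11 * (n : ℝ)) * Real.log n = u * Real.log n + 11 * (n * Real.log n) := by ring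
  have p4 : (u + (6 * (n : ℝ) + 1)) * Real.log n = u * Real.log n + 6 * (n * Real.log n) + Real.log n := by ring
  have p5 : (u + (24 * (n : ℝ) + 1)) * Real.log n = u * Real.log n + 24 * (n * Real.log n) + Real.log n := by ring
  have p6 : (u + 13 * (n : ℝ)) * Real.log n = u * Real.log n + 13 * (n * Real.log n) := by ring
  have p7 : (u + (26 * (n : ℝ) + 1)) * Real.log n = u * Real.log n + 26 * (n * Real.log n) + Real.log n := by ring
  have p8 : (u + 15 * (n : ℝ)) * Real.log n = u * Real.log n + 15 * (n * Real.log n) := by ring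
  have q11 : (11 * (n : ℝ)) * (Real.log 11 + Real.log n) = 11 * (n * Real.log 11) + 11 * (n * Real.log n) := by ring
  have q17 : (17 * (n : ℝ)) * (Real.log 17 + Real.log n) = 17 * (n * Real.log 17) + 17 * (n * Real.log n) := by ring
  have q5 : (5 * (n : ℝ)) * (Real.log 5 + Real.log n) = 5 * (n * Real.log 5) + 5 * (n * Real.log n) := by ring
  have r2n : (2 * (n : ℝ)) * prim η (703 / 100) = 2 * (n * prim η (703 / 100)) := by ring
  have r2n' : (2 * (n : ℝ)) * prim η (-147 / 100) = 2 * (n * prim η (-147 / 100)) := by ring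
  have hG : (n : ℝ) * profileT0 (-897 / 100) η
      = 2 * (n * prim η (703 / 100)) - 2 * (n * prim η (-147 / 100))
        + (n * prim η (203 / 100) - n * prim η (-297 / 100))
        - (n * prim η (1503 / 100) - n * prim η (403 / 100))
        - (n * prim η (1703 / 100) - n * prim η (603 / 100))
        + (22 * (n * Real.log 11) - 17 * (n * Real.log 17) - 5 * (n * Real.log 5) + 17 * (n * Real.log 2)) := by
    unfold profileT0 profileTConst
    simp only [gPrim_eq_prim]
    norm_num
    ring
  have hK := lipKT_nonneg η
  have hKdef : lipKT η = |Real.log (9 / 10)| + Real.log (22 ^ 2 + η ^ 2) / 2 := rfl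
  have hK0 : K0T = 20 * |Real.log (9 / 10)| + 3 * Real.log 2 + Real.log 11 + 4 := rfl
  rw [hN] at hB
  rw [hG, hK0]
  linarith [e1a, e1b, e2a, e2b, e3a, e3b, e4a, e4b, e5a, e5b, e6a, e6b, e7a, e7b, e8a, e8b, l1, l2, l3, l4,
    s11, s17, s5, p1, p2, p3, p4, p5, p6, p7, p8, q11, q17, q5, r2n, r2n', hB, hK, hKdef, hlogn, hlog17, hlog5,
    hlog11, hlog2]

end Summit.KontsevichZagierPeriods.Zeta5Search.TwoTaleLineBound

end
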